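import Mathlib
import Literature.Analysis.FluidPDE.Tao2016AveragedNS.BoundedEternalSolutions
import Summits.NavierStokesRegularity.NavierStokesRegularity.Theorems.TaoLadderRungTwoBreakBlowupRigidityOneRenormalisedFlow
import Summits.NavierStokesRegularity.NavierStokesRegularity.Theorems.TaoLadderRungTwoBreakBlowupRigidityOneCriticalRate
import Summits.NavierStokesRegularity.NavierStokesRegularity.Theorems.TaoLadderRungTwoBreakBlowupRigidityOneEnergyBound
import HarnessLib

/-!
# The RENORMALISED ROBUST BLOW-UP as a non-degenerate solution of the inviscid eternal law on a
  half-line, and the type-I ⇒ equi-Lipschitz step — assembly of the physical-time kit for the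
  extraction stub `stub_eternalFromBlowup` of K2(1) `TaoLadderRungTwoBreak.BlowupRigidityOne`
  (stmt-NavierStokesRegularity-20206)

MODEL lattice ODEs only (Tao 2016 §4 (4.12), §6.4); nothing here is a statement about the Navier–Stokes
equations; NO item is closed (`--supports stmt-NavierStokesRegularity-20206`). Route-independent; general `m`.

* `blowupProfile_of_noGlobalCascade` — ONE STATEMENT of what robust blow-up (`NoGlobalCascade ε₀ α X₀`,
  `α ∈ E₂(R)`) delivers UNCONDITIONALLY toward the stub `∃ W, IsEternal ε₀ α W ∧ EternalSurvivingFwd 1 ε₀ W`: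
  a blow-up time `T⋆ > 0` and the maximal exact flow `X` (datum, no shells below `0`, exact motion,
  (4.5)-regular before `T⋆`, amplitudes `≤ ‖X₀‖`, critical amplitude unbounded on shells `k → ∞`) whose
  renormalisation `W_n(σ) = Λ^n e^{-σ} x_n(T⋆ - e^{-σ})` (i) satisfies the law of `IsEternal` at every
  `σ` with `e^{-σ} < T⋆` and (ii) is NON-DEGENERATE: `sup_n ‖W_n(σ)‖ ≥ 1/(m²(3+Λ))` at every such `σ`
  (no ω-limit of its translates can vanish). Sources: `maximalExactFlow_of_noGlobalCascade`,
  `highShellBlowup_of_noGlobalCascade`, `criticalRate_of_noGlobalCascade`, `renormalisedFlow_law`.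
* `renormalisedFlow_deriv_bound` / `renormalisedFlow_lipschitz_of_typeI` — the COMPACTNESS INPUT under the
  open type-I hypothesis (N-39): if `Λ^n(T-t)‖x_n(t)‖ ≤ C` then on the half-line every `W_n` has
  derivative bounded by `K(C) = C + (s₀₀₀ + Λ s₀₀₁)C² + Λ⁻¹(s₁₀₀+s₀₁₀)C²` (`s_μ = shiftConst α μ`), hence the
  translates `W_{·+m}(· + s)` are uniformly bounded and equi-Lipschitz — the hypotheses of Arzelà–Ascoli
  in the (viscous, proved) extraction ⟨22744⟩.

What remains for the stub after this file: type I (N-39), forward (S₁)-survival of the blow-up, the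
per-shell action bound, and the passage to an ω-limit on all of `ℝ` (see the item's census evidence).
-/

noncomputable section

-- the summit and its single sub-problem share the name (CONVENTIONS §1)
set_option linter.dupNamespace false

open Set Filter Topology

namespace Summit.NavierStokesRegularity.NavierStokesRegularity.Theorems

namespace BlowupRigidityOne

open Literature.Analysis.FluidPDE Literature.Analysis.FluidPDE.TaoCascade
open DSSOneShift (bigLam_zpow_eq_rpow)

variable {m : ℕ}

/-! ### Type I ⇒ bounded derivatives on the half-line (equi-Lipschitz translates) -/

/-- **TYPE I ⇒ BOUNDED LOG-TIME DERIVATIVES.** Let `X` be an exact flow on `[0,T)` (`C¹` on `[0,T)`, exact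
one-sided law), `W` its renormalisation around `T`, and assume the TYPE-I bound
`Λ^n (T-t)‖x_n(t)‖ ≤ C` for all `n` and `0 ≤ t < T`. Then at every `σ` with `e^{-σ} < T` the shell `W_n`
is differentiable with `‖W_n'(σ)‖ ≤ C + (s₀₀₀ + Λ s₀₀₁) C² + Λ⁻¹ (s₁₀₀ + s₀₁₀) C²`
(`s_μ = shiftConst α μ`; the law `renormalisedFlow_law` and the norm bounds of `tableQ/A/B`).
[cite: Tao2016AveragedNS, §6.4 and §4 (4.8); cell vocabulary (`UniformBound`)] -/
theorem renormalisedFlow_deriv_bound {ε₀ T C : ℝ} (hε : 0 < ε₀)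
    {α : Fin m → Fin m → Fin m → ℤ × ℤ × ℤ → ℝ}
    {X : Fin m → ℤ → ℝ → ℝ} (hC1 : ∀ i n, ContDiffOn ℝ 1 (X i n) (Set.Ico 0 T))
    (hmot : ∀ i n t, 0 ≤ t → t < T → derivWithin (X i n) (Set.Ici 0) t = quadTerm ε₀ α X i n t)
    {W : ℤ → ℝ → Em m}
    (hW : ∀ n σ, W n σ = (bigLam ε₀ ^ n * Real.exp (-σ)) • shellVec X n (T - Real.exp (-σ)))
    (htypeI : ∀ (n : ℤ) (t : ℝ), 0 ≤ t → t < T → bigLam ε₀ ^ n * (T - t) * ‖shellVec X n t‖ ≤ C)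
    (n : ℤ) {σ : ℝ} (hσ : Real.exp (-σ) < T) :
    ∃ W' : Em m, HasDerivAt (W n) W' σ ∧
      ‖W'‖ ≤ C + (shiftConst α (0, 0, 0) + bigLam ε₀ * shiftConst α (0, 0, 1)) * C ^ 2
        + (bigLam ε₀)⁻¹ * (shiftConst α (1, 0, 0) + shiftConst α (0, 1, 0)) * C ^ 2 := by
  have hL : 0 < bigLam ε₀ := bigLam_pos (by linarith)
  refine ⟨_, renormalisedFlow_law hε hC1 hmot hW n hσ, ?_⟩
  -- every shell of `W` is bounded by `C` at this log-time
  have hbd : ∀ k : ℤ, ‖W k σ‖ ≤ C := fun k =>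
    (uniformBound_iff_typeI (C := C) hε hW).2 htypeI k σ hσ.le
  have hC0 : 0 ≤ C := (norm_nonneg _).trans (hbd n)
  have h1 : ‖-((1 : ℝ) • W n σ)‖ ≤ C := by rw [norm_neg, one_smul]; exact hbd n
  have h2 : ‖tableQ α (W n σ)‖ ≤ shiftConst α (0, 0, 0) * C ^ 2 :=
    (norm_tableQ_le α _).trans (mul_le_mul_of_nonneg_left
      (pow_le_pow_left₀ (norm_nonneg _) (hbd n) 2) (shiftConst_nonneg α _))
  have h3 : ‖bigLam ε₀ • tableA α (W (n - 1) σ)‖ ≤ bigLam ε₀ * (shiftConst α (0, 0, 1) * C ^ 2) := by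
    rw [norm_smul, Real.norm_eq_abs, abs_of_pos hL]
    exact mul_le_mul_of_nonneg_left ((norm_tableA_le α _).trans (mul_le_mul_of_nonneg_left
      (pow_le_pow_left₀ (norm_nonneg _) (hbd (n - 1)) 2) (shiftConst_nonneg α _))) hL.le
  have h4 : ‖(bigLam ε₀)⁻¹ • tableB α (W (n + 1) σ) (W n σ)‖ ≤
      (bigLam ε₀)⁻¹ * ((shiftConst α (1, 0, 0) + shiftConst α (0, 1, 0)) * C * C) := by
    rw [norm_smul, Real.norm_eq_abs, abs_of_pos (inv_pos.2 hL)]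
    refine mul_le_mul_of_nonneg_left ((norm_tableB_le α _ _).trans ?_) (inv_pos.2 hL).le
    have hs : 0 ≤ shiftConst α (1, 0, 0) + shiftConst α (0, 1, 0) :=
      add_nonneg (shiftConst_nonneg α _) (shiftConst_nonneg α _)
    exact mul_le_mul (mul_le_mul_of_nonneg_left (hbd (n + 1)) hs) (hbd n) (norm_nonneg _)
      (mul_nonneg hs hC0)
  calc ‖-((1 : ℝ) • W n σ) + tableQ α (W n σ) + bigLam ε₀ • tableA α (W (n - 1) σ)
        + (bigLam ε₀)⁻¹ • tableB α (W (n + 1) σ) (W n σ)‖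
      ≤ ‖-((1 : ℝ) • W n σ)‖ + ‖tableQ α (W n σ)‖ + ‖bigLam ε₀ • tableA α (W (n - 1) σ)‖
        + ‖(bigLam ε₀)⁻¹ • tableB α (W (n + 1) σ) (W n σ)‖ := by
          refine (norm_add_le _ _).trans (add_le_add ((norm_add_le _ _).trans
            (add_le_add (norm_add_le _ _) le_rfl)) le_rfl)
    _ ≤ C + shiftConst α (0, 0, 0) * C ^ 2 + bigLam ε₀ * (shiftConst α (0, 0, 1) * C ^ 2)
        + (bigLam ε₀)⁻¹ * ((shiftConst α (1, 0, 0) + shiftConst α (0, 1, 0)) * C * C) :=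
          add_le_add (add_le_add (add_le_add h1 h2) h3) h4
    _ = _ := by ring

/-- **TYPE I ⇒ EQUI-LIPSCHITZ ON THE HALF-LINE.** Under the type-I bound, every shell of the renormalised
flow is `K`-Lipschitz on `{σ : e^{-σ} < T}` with the constant `K` of `renormalisedFlow_deriv_bound`
(uniform in the shell): `‖W_n(σ₂) - W_n(σ₁)‖ ≤ K (σ₂ - σ₁)` for `σ₁ ≤ σ₂`, `e^{-σ₁} < T`. Hence the
translates `W_{·+m}(· + s)` are uniformly bounded (`uniformBound_iff_typeI`) and equi-Lipschitz — the
Arzelà–Ascoli input of an ω-limit extraction. [cite: Tao2016AveragedNS, §6.4; Teschl2012, §2.6] -/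
theorem renormalisedFlow_lipschitz_of_typeI {ε₀ T C : ℝ} (hε : 0 < ε₀)
    {α : Fin m → Fin m → Fin m → ℤ × ℤ × ℤ → ℝ}
    {X : Fin m → ℤ → ℝ → ℝ} (hC1 : ∀ i n, ContDiffOn ℝ 1 (X i n) (Set.Ico 0 T))
    (hmot : ∀ i n t, 0 ≤ t → t < T → derivWithin (X i n) (Set.Ici 0) t = quadTerm ε₀ α X i n t)
    {W : ℤ → ℝ → Em m}
    (hW : ∀ n σ, W n σ = (bigLam ε₀ ^ n * Real.exp (-σ)) • shellVec X n (T - Real.exp (-σ)))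
    (htypeI : ∀ (n : ℤ) (t : ℝ), 0 ≤ t → t < T → bigLam ε₀ ^ n * (T - t) * ‖shellVec X n t‖ ≤ C)
    (n : ℤ) {σ₁ σ₂ : ℝ} (hσ₁ : Real.exp (-σ₁) < T) (h12 : σ₁ ≤ σ₂) :
    ‖W n σ₂ - W n σ₁‖ ≤ (C + (shiftConst α (0, 0, 0) + bigLam ε₀ * shiftConst α (0, 0, 1)) * C ^ 2
        + (bigLam ε₀)⁻¹ * (shiftConst α (1, 0, 0) + shiftConst α (0, 1, 0)) * C ^ 2) * (σ₂ - σ₁) := by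
  set K : ℝ := C + (shiftConst α (0, 0, 0) + bigLam ε₀ * shiftConst α (0, 0, 1)) * C ^ 2
    + (bigLam ε₀)⁻¹ * (shiftConst α (1, 0, 0) + shiftConst α (0, 1, 0)) * C ^ 2 with hKdef
  -- derivatives along `[σ₁, σ₂]` (all inside the half-line)
  have hhalf : ∀ τ ∈ Icc σ₁ σ₂, Real.exp (-τ) < T := fun τ hτ =>
    lt_of_le_of_lt (Real.exp_le_exp.2 (by linarith [hτ.1])) hσ₁
  choose D hD using fun τ : Icc σ₁ σ₂ =>
    renormalisedFlow_deriv_bound hε hC1 hmot hW htypeI n (hhalf τ.1 τ.2)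
  have hderiv : ∀ τ ∈ Icc σ₁ σ₂, HasDerivWithinAt (W n) (deriv (W n) τ) (Icc σ₁ σ₂) τ := by
    intro τ hτ
    exact ((hD ⟨τ, hτ⟩).1.differentiableAt.hasDerivAt).hasDerivWithinAt
  have hbound : ∀ τ ∈ Ico σ₁ σ₂, ‖deriv (W n) τ‖ ≤ K := by
    intro τ hτ
    have h := hD ⟨τ, Ico_subset_Icc_self hτ⟩
    rw [h.1.deriv]
    exact h.2
  have key := norm_image_sub_le_of_norm_deriv_le_segment' hderiv hbound σ₂ (right_mem_Icc.2 h12)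
  exact key

/-! ### Assembly: the renormalised robust blow-up -/

/-- **THE RENORMALISED ROBUST BLOW-UP IS A NON-DEGENERATE SOLUTION OF THE INVISCID ETERNAL LAW ON A
HALF-LINE.** Let `NoGlobalCascade ε₀ α X₀` with `ε₀ > 0`, `α ∈ E₂(R)` (any `m`). There are a blow-up time
`T > 0` and the maximal exact cascade flow `X` from the one-shell datum (`C¹` on `[0,T)`, datum, no shells
below `0`, exact motion, (4.5)-regular before `T`, amplitudes `≤ √(Σ X₀ᵢ²)`, critical amplitude
`(1+ε₀)^{5k/2}|X_{i,k}|` exceeding every level on shells `k > K` for every `K`) such that EVERY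
renormalisation `W_n(σ) = (Λ^n e^{-σ}) • x_n(T - e^{-σ})` (i) satisfies the law of `IsEternal ε₀ α` at each
`σ` with `e^{-σ} < T`, and (ii) is non-degenerate there: for every `L` with `L · m²(3+Λ) < 1` some shell has
`‖W_n(σ)‖ > L`. What separates this from the conclusion `∃ W, IsEternal ε₀ α W ∧ EternalSurvivingFwd 1 ε₀ W`
of the extraction stub: the law on ALL of `ℝ` (ω-limit: type I + compactness), the admissibility clauses
(`action`, `bdd`) and forward (S₁)-survival.
[cite: Tao2016AveragedNS, §4 Thm. 4.2, (4.12), §6.4; Teschl2012, §2.6] -/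
theorem blowupProfile_of_noGlobalCascade {ε₀ R : ℝ} (hε : 0 < ε₀)
    {α : Fin m → Fin m → Fin m → ℤ × ℤ × ℤ → ℝ} {X₀ : Fin m → ℝ} (hα : InTableClass R α)
    (hNG : NoGlobalCascade ε₀ α X₀) :
    ∃ (T : ℝ) (X : Fin m → ℤ → ℝ → ℝ), 0 < T ∧
      (∀ i n, ContDiffOn ℝ 1 (X i n) (Set.Ico 0 T)) ∧
      (∀ i n, X i n 0 = if n = 0 then X₀ i else 0) ∧
      (∀ i n t, n < 0 → X i n t = 0) ∧
      (∀ i n t, 0 ≤ t → t < T → derivWithin (X i n) (Set.Ici 0) t = quadTerm ε₀ α X i n t) ∧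
      (∀ T' : ℝ, 0 < T' → T' < T → ∃ M : ℝ, ∀ t : ℝ, 0 ≤ t → t ≤ T' →
        ∀ (i : Fin m) (n : ℤ), (1 + (1 + ε₀) ^ ((10 : ℝ) * n)) * |X i n t| ≤ M) ∧
      (∀ t ∈ Ico (0 : ℝ) T, ∀ (i : Fin m) (k : ℤ), |X i k t| ≤ Real.sqrt (∑ j, X₀ j ^ 2)) ∧
      (∀ (K : ℤ) (L : ℝ), ∃ t : ℝ, 0 ≤ t ∧ t < T ∧
        ∃ (i : Fin m) (k : ℤ), K < k ∧ L < (1 + ε₀) ^ ((5 : ℝ) * k / 2) * |X i k t|) ∧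
      ∀ W : ℤ → ℝ → Em m,
        (∀ n σ, W n σ = (bigLam ε₀ ^ n * Real.exp (-σ)) • shellVec X n (T - Real.exp (-σ))) →
        (∀ (n : ℤ) (σ : ℝ), Real.exp (-σ) < T →
          HasDerivAt (W n) (-((1 : ℝ) • W n σ) + tableQ α (W n σ) + bigLam ε₀ • tableA α (W (n - 1) σ)
            + (bigLam ε₀)⁻¹ • tableB α (W (n + 1) σ) (W n σ)) σ) ∧
        (∀ σ : ℝ, Real.exp (-σ) < T → ∀ L : ℝ, L * ((m : ℝ) ^ 2 * (3 + bigLam ε₀)) < 1 →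
          ∃ n : ℤ, L < ‖W n σ‖) := by
  -- both corollaries are about THE SAME maximal exact flow: re-derive them from one `X`
  obtain ⟨T, X, hT, h1, h2, h3, h4, h5, hamp, hhigh⟩ := highShellBlowup_of_noGlobalCascade hε hα hNG
  have hl0 : (0 : ℝ) < 1 + ε₀ := by linarith
  refine ⟨T, X, hT, h1, h2, h3, h4, h5, hamp, hhigh, fun W hW => ⟨fun n σ hσ =>
    renormalisedFlow_law hε h1 h4 hW n hσ, fun σ hσ L hL => ?_⟩⟩
  -- the rate lower bound for this flow (its critical amplitude is unbounded by `hhigh`)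
  have hα' := abs_restrictShiftSet_le zero_le_one (abs_le_one_of_inTableClass hα)
  have hder : ∀ i k, ∀ τ ∈ Ico (0 : ℝ) T,
      HasDerivWithinAt (X i k) (quadTerm ε₀ (restrictShiftSet α) X i k τ) (Ici 0) τ := by
    intro i k τ hτ
    have hd : DifferentiableWithinAt ℝ (X i k) (Ico 0 T) τ :=
      ((h1 i k).differentiableOn one_ne_zero) τ hτ
    have hd' : DifferentiableWithinAt ℝ (X i k) (Ici 0) τ :=
      hd.mono_of_mem_nhdsWithin (by
        rw [mem_nhdsWithin]
        exact ⟨Iio T, isOpen_Iio, hτ.2, fun x hx => ⟨hx.2, hx.1⟩⟩)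
    rw [quadTerm_restrictShiftSet, ← h4 i k τ hτ.1 hτ.2]
    exact hd'.hasDerivWithinAt
  have hreg : ∀ T' : ℝ, T' < T → ∃ M : ℝ, ∀ τ ∈ Icc (0 : ℝ) T', ∀ (i : Fin m) (k : ℤ),
      (1 + (1 + ε₀) ^ ((10 : ℝ) * k)) * |X i k τ| ≤ M := by
    intro T' hT'
    rcases le_or_gt T' 0 with h0 | h0
    · obtain ⟨M, hM⟩ := h5 (T / 2) (by linarith) (by linarith)
      exact ⟨M, fun τ hτ i k => hM τ hτ.1 (by linarith [hτ.2]) i k⟩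
    · obtain ⟨M, hM⟩ := h5 T' h0 hT'
      exact ⟨M, fun τ hτ i k => hM τ hτ.1 hτ.2 i k⟩
  have hunb : ∀ L : ℝ, ∃ τ ∈ Ico (0 : ℝ) T, ∃ (i : Fin m) (k : ℤ),
      L < (1 + ε₀) ^ ((5 : ℝ) * k / 2) * |X i k τ| := fun L => by
    obtain ⟨τ, hτ0, hτT, i, k, -, h⟩ := hhigh 0 L
    exact ⟨τ, ⟨hτ0, hτT⟩, i, k, h⟩
  -- the physical time `t = T - e^{-σ}`
  set E : ℝ := Real.exp (-σ) with hEdef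
  have hE : 0 < E := Real.exp_pos _
  have ht : T - E ∈ Ico (0 : ℝ) T := ⟨by linarith, by linarith⟩
  have hrate := critical_rate_lower_bound hε.le zero_le_one hα' hder hreg hunb (T - E) ht (L / E) (by
    rw [sub_sub_cancel]
    calc L / E * ((m : ℝ) ^ 2 * 1 * (3 + bigLam ε₀) * E)
        = L * ((m : ℝ) ^ 2 * (3 + bigLam ε₀)) := by field_simp
      _ < 1 := hL)
  obtain ⟨i, k, hlt⟩ := hrate
  refine ⟨k, ?_⟩
  -- `‖W k σ‖ = Λ^k E ‖x_k(T - E)‖ ≥ Λ^k E |X_{i,k}(T-E)| > L`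
  have hL' : 0 < bigLam ε₀ := bigLam_pos (by linarith)
  rw [bigLam_zpow_eq_rpow hl0 k] at hlt
  rw [renormalisedFlow_norm hε hW, ← hEdef]
  have hcomp : |X i k (T - E)| ≤ ‖shellVec X k (T - E)‖ := by
    have hsq : |X i k (T - E)| ^ 2 ≤ ‖shellVec X k (T - E)‖ ^ 2 := by
      rw [EuclideanSpace.norm_eq, Real.sq_sqrt (Finset.sum_nonneg fun j _ => by positivity)]
      have := Finset.single_le_sum (f := fun j => ‖shellVec X k (T - E) j‖ ^ 2)
        (fun _ _ => by positivity) (Finset.mem_univ i)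
      simpa [shellVec, Real.norm_eq_abs] using this
    rw [← Real.sqrt_sq (abs_nonneg (X i k (T - E))), ← Real.sqrt_sq (norm_nonneg (shellVec X k (T - E)))]
    exact Real.sqrt_le_sqrt hsq
  have hΛE : 0 ≤ bigLam ε₀ ^ k * E := (mul_pos (zpow_pos hL' k) hE).le
  rw [div_lt_iff₀ hE] at hlt
  calc L < bigLam ε₀ ^ k * |X i k (T - E)| * E := hlt
    _ = bigLam ε₀ ^ k * E * |X i k (T - E)| := by ring
    _ ≤ bigLam ε₀ ^ k * E * ‖shellVec X k (T - E)‖ := mul_le_mul_of_nonneg_left hcomp hΛE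

end BlowupRigidityOne

end Summit.NavierStokesRegularity.NavierStokesRegularity.Theorems

end
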